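import Literature.NumberTheory.EllipticCurves.ZpExtensionGaloisTwistLocalDescentProofs
import Literature.NumberTheory.EllipticCurves.ZpExtensionGaloisTwistSharpFlatSelmerStructure
import Literature.NumberTheory.EllipticCurves.Sprung2012.LocalTowerLayersProofs
import Summits.BirchSwinnertonDyer.BirchSwinnertonDyer.Theorems.ByReductionTypeAtTwoSupersingularFlatColemanClauses
import Mathlib.NumberTheory.Padics.PadicIntegers
import HarnessLib

/-!
# Route `ByReductionTypeAtTwo` (rung K4), crux `SupersingularRankZeroAtTwo` (item stmt-BirchSwinnertonDyer-19097), line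
# `odd_blind_package`, slot 5 `stub_CD` = CDC_H, hand h9 = HT-C7locE = (hE), conjunct (C) (the LINE BOUND): **THE CLASS OF A POINT** —
# a tower point `x ∈ E(K_∞·K_v)` which is (i) annihilated by `𝒦` modulo `2^J`, (ii) anti-invariant modulo `2^J`
# (`g⁻¹x + x ∈ 2^J E(K_∞·K_v)`) and (iii) primitive (`z₀(x)` odd for some functional) gives `2^J` DISTINCT classes in Sprung's
# twisted ♭-condition `twistedSharpFlatLocalKummer 2 κ J (−1) _ E (E(K_∞·K_v)) 𝒦 ≤ H¹(Γ_E, E[2^J](ψ₂))`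
# (cell `bsd-2adic`, seat `bsd-2adic-tower-1` GEN 62; any `K` of characteristic `0`, any completion `E`)

HONEST FRAMING: THEOREMS ONLY (no definition, no named fact, no instance, no `sorry`); a helper `--supports 19097`; the cohomological half of
the line bound `2^J ≤ #L^E_J` of the hand (hE); the tower point is supplied by ★★ `exists_linePoint` (p-LinePoint); nothing is booked;
BSD is proved for no curve by any of this. bears_on: K4 (19097).

## The construction (Greenberg p. 108 / p. 124 at `v ∣ p`, with the twist inserted; pattern of the tree's
`exists_twistedTorsionToLocalH1_eq_of_zsmul_conjH1_eq` at `v ∤ p`)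

`2^J Q = x` (`E(K̄_E)` divisible); on `H = Gal(K̄_E/(K_∞)_w)` (which fixes `x`) `τ ↦ τQ − Q` is a continuous cocycle with values in
`E[2^J]`, read in the twisted module `E[2^J](ψ₂)|_{Γ_E}` (the twist is invisible on `H`); its class is fixed by the TWISTED conjugation by
`g` (`g` acts by `−g`; `−(τ(gQ+Q) − (gQ+Q)) = τP′ − P′` with `P′ = g•w − (gQ + Q)` a `2^J`-torsion point, `2^J w = g⁻¹x + x`); since
`Γ_E/H ≅ ℤ₂` (`κ_E`), `res : H¹(Γ_E, E[2^J](ψ₂)) → H¹(H, ·)^{g}` is ONTO (`exists_resSubgroup_eq_of_conjMap_eq_of_padicInt`, `cd₂ ℤ₂ = 1`),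
giving a class `ξ`; any representative is `τ ↦ τ(Q + b) − (Q + b)` on `H` (`b ∈ E[2^J]`), so `ξ` lies in the ♭-condition with datum
`(Q + b, J)` by (i).  If `d•ξ = 0` then `d•Q ∈ E(K_∞·K_v) + E[2^J]`, so `d•x ∈ 2^J E(K_∞·K_v)` and `2^J ∣ d·z₀(x)`, whence `2^J ∣ d` by (iii):
the multiples `i•ξ`, `i < 2^J`, are distinct.

* ★★ `pow_le_natCard_twistedSharpFlatLocalKummer_of_point` — the statement above (`H¹` finite as a hypothesis; over `ℚ_v` it is Milne ADT I 2.3,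
  tree `finite_galoisCohomology_one_adicCompletion`).

References: [GreenbergLNM1716] R. Greenberg, LNM 1716 (1999), §3 Lemma 3.2, §4 pp. 107–108, 122–124; [Sprung2012] F. Sprung, J. Number
Theory 132 (2012), Def. 7.9 / 7.11 (p. 1503); [SerreGaloisCohomology1997] I §2.6 (b); [NeukirchSchmidtWingberg2008] (1.6.7), I §1 (1.1.8).
-/

set_option autoImplicit false
set_option linter.dupNamespace false

noncomputable section

open scoped Classical

open CategoryTheory Field

universe u

namespace Summit.BirchSwinnertonDyer.BirchSwinnertonDyer.Theorems

namespace OddBlindLocal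

open Literature.NumberTheory.EllipticCurves Literature.NumberTheory.GaloisRepresentations ZpExtension
  Literature.NumberTheory.EllipticCurves.Kobayashi2003 Literature.NumberTheory.EllipticCurves.Sprung2017
  Literature.NumberTheory.EllipticCurves.Sprung2012 WeierstrassCurve ContinuousCohomology TopRep ContRepresentation

section Generic

variable {K : Type u} [Field K] [CharZero K] (W : WeierstrassCurve K) [W.IsElliptic]
  (κ : ZpExtension K 2) (J : ℕ) (hu : ((2 : ℕ) : ℤ) ∣ (-1 : ℤ) - 1)
  (E : Type u) [Field E] [Algebra K E]

set_option maxHeartbeats 1600000 in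
/-- ★★ **THE CLASS OF A POINT: `2^J` distinct classes in the twisted ♭-condition.**  `K` of characteristic `0`, `E` a completion, `κ` a
`ℤ₂`-extension, `H = Gal(K̄_E/(K_∞)_w)` the local subgroup with a continuous `κ_E : Γ_E → ℤ₂` cutting it out and `κ_E(g) = 1`,
`κ(g|_{K̄}) = 1`; the tower `E(K_∞·K_v)` without `2`-torsion; `𝒦` any set of functionals on it.  If a tower point `x` satisfies
(i) `2^J ∣ z(x)` for all `z ∈ 𝒦`, (ii) `g⁻¹x + x = 2^J w` with `w` in the tower, (iii) `2 ∤ z₀(x)` for some functional `z₀`, and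
`H¹(Γ_E, E[2^J](ψ₂))` is finite, then `2^J ≤ #twistedSharpFlatLocalKummer 2 κ J (−1) _ E (E(K_∞·K_v)) 𝒦`.  See the module docstring.
[cite: GreenbergLNM1716, §3 Lemma 3.2 and §4 pp. 108, 124] [cite: Sprung2012, Def. 7.9 and Def. 7.11 (p. 1503)]
[cite: SerreGaloisCohomology1997, I §2.6 (b)] [cite: NeukirchSchmidtWingberg2008, (1.6.7)] -/
theorem pow_le_natCard_twistedSharpFlatLocalKummer_of_point
    (hnt : ∀ P ∈ localTowerPointsOfEmb κ (closureEmb (K := K) E) W, 2 • P = 0 → P = 0)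
    (κE : absoluteGaloisGroup E →ₜ* Multiplicative ℤ_[2])
    (hL : ∀ σ : absoluteGaloisGroup E, σ ∈ localSubgroup κ.kerSubgroup E ↔ κE σ = 1)
    {g : absoluteGaloisGroup E} (hg1 : κE g = Multiplicative.ofAdd 1)
    (hκg : κ.IsTopGenerator (resGal (K := K) E g))
    (𝒦 : Set (↥(localTowerPointsOfEmb κ (closureEmb (K := K) E) W) →+ ℤ_[2]))
    {x : localPoints W E} (hxM : x ∈ localTowerPointsOfEmb κ (closureEmb (K := K) E) W)
    (hdiv : ∀ z ∈ 𝒦, (2 : ℤ_[2]) ^ J ∣ z ⟨x, hxM⟩)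
    (hanti : ∃ w ∈ localTowerPointsOfEmb κ (closureEmb (K := K) E) W, 2 ^ J • w = g⁻¹ • x + x)
    (hprim : ∃ z₀ : ↥(localTowerPointsOfEmb κ (closureEmb (K := K) E) W) →+ ℤ_[2], ¬ (2 : ℤ_[2]) ∣ z₀ ⟨x, hxM⟩)
    (hfin : Finite (galoisCohomology ((W.twistedTorsionGaloisModule 2 κ J (-1) hu).restrictField E) 1)) :
    2 ^ J ≤ Nat.card ↥(W.twistedSharpFlatLocalKummer 2 κ J (-1) hu E (localTowerPointsOfEmb κ (closureEmb (K := K) E) W) 𝒦) := by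
  -- notation
  let G : Type u := absoluteGaloisGroup E
  let Pt : Type u := localPoints W E
  let Hi : Subgroup G := localSubgroup κ.kerSubgroup E
  let M : AddSubgroup Pt := localTowerPointsOfEmb κ (closureEmb (K := K) E) W
  haveI : CompactSpace G := absoluteGaloisGroup_compactSpace E
  have galois_smul_nsmul : ∀ (τ : G) (n : ℕ) (P : Pt), τ • (n • P) = n • (τ • P) :=
    fun τ n P ↦ map_nsmul (DistribSMul.toAddMonoidHom Pt τ) n P
  have galois_smul_zsmul : ∀ (τ : G) (n : ℤ) (P : Pt), τ • (n • P) = n • (τ • P) :=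
    fun τ n P ↦ map_zsmul (DistribSMul.toAddMonoidHom Pt τ) n P
  have hfix : ∀ {P : Pt}, P ∈ M → ∀ τ : Hi, (τ : G) • P = P := fun hP τ ↦
    (mem_localTowerPointsOfEmb_iff κ _ W _).1 hP τ τ.2
  have hstab : ∀ (h : G) {P : Pt}, P ∈ M → h • P ∈ M := fun h P hP ↦ smul_mem_localTowerPointsOfEmb κ _ W h hP
  -- (1) `2^J Q = x`
  let n : ℤ := ((2 ^ J : ℕ) : ℤ)
  have hn : n ≠ 0 := by
    change ((2 ^ J : ℕ) : ℤ) ≠ 0; exact_mod_cast pow_ne_zero _ two_ne_zero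
  obtain ⟨Q, hQ⟩ : ∃ Q : Pt, n • Q = x := (W.baseChange (AlgebraicClosure E)).zsmul_surjective_of_isAlgClosed hn x
  have hQ' : 2 ^ J • Q = x := by rw [← hQ]; change ((2 ^ J : ℕ) : ℤ) • Q = _; rw [natCast_zsmul]
  -- (2) the `E[2^J]`-valued cocycle `f τ = τQ − Q` on `H`
  let f : Hi → Pt := fun τ ↦ (τ : G) • Q - Q
  have hfdef : ∀ τ : Hi, f τ = (τ : G) • Q - Q := fun _ ↦ rfl
  have hfn : ∀ τ : Hi, f τ ∈ AddSubgroup.torsionBy Pt n := by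
    intro τ
    refine (Submodule.mem_torsionBy_iff _ _).mpr ?_
    change n • ((τ : G) • Q - Q) = 0
    rw [smul_sub, ← galois_smul_zsmul, hQ, hfix hxM τ, sub_self]
  have hfmul : ∀ σ τ : Hi, f (σ * τ) = f σ + (σ : G) • f τ := by
    intro σ τ
    rw [hfdef, hfdef, hfdef, Subgroup.coe_mul, mul_smul, smul_sub]
    abel
  -- the torsion comparison `E[2^J](K̄) ≃ E(K̄_E)[2^J]`
  let B : Type u := geomTorsion W n
  let θ : B ≃+ AddSubgroup.torsionBy Pt n := W.torsionPointsEquiv n (E := E) hn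
  let ι : B → Pt := fun b ↦ pointsMap W E (b : W.geomPoints)
  have hιinj : Function.Injective ι := fun a b hab ↦ θ.injective (Subtype.ext hab)
  have hιadd : ∀ a b : B, ι (a + b) = ι a + ι b := fun a b ↦ by
    change pointsMap W _ ((a : W.geomPoints) + b) = _; rw [map_add]
  have hιsub : ∀ a b : B, ι (a - b) = ι a - ι b := fun a b ↦ by
    change pointsMap W _ ((a : W.geomPoints) - b) = _; rw [map_sub]
  have hιnsmul : ∀ (c : ℕ) (a : B), ι (c • a) = c • ι a := fun c a ↦ by
    change pointsMap W _ (((c • a : B) : W.geomPoints)) = _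
    rw [AddSubgroupClass.coe_nsmul, map_nsmul]
  have hιneg : ∀ a : B, ι (-a) = -ι a := fun a ↦ by
    change pointsMap W _ (((-a : B) : W.geomPoints)) = _; rw [NegMemClass.coe_neg, map_neg]
  have hιgal : ∀ (σ : G) (a : B), ι (resGal (K := K) E σ • a) = σ • ι a := fun σ a ↦ by
    change pointsMap W _ (((resGal (K := K) E σ • a : B) : W.geomPoints)) = _
    rw [Literature.NumberTheory.EllipticCurves.AddSubgroup.torsionBy.coe_smul, pointsMap_smul]
  have hιθsymm : ∀ T : AddSubgroup.torsionBy Pt n, ι (θ.symm T) = T := fun T ↦ W.pointsMap_torsionPointsEquiv_symm n hn T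
  have hιn : ∀ b : B, 2 ^ J • ι b = 0 := fun b ↦ by
    rw [← hιnsmul, W.pow_nsmul_geomTorsion_pow 2 J b]; change pointsMap W E 0 = 0; exact map_zero _
  -- `fB = θ⁻¹ ∘ f`, continuous
  let fT : Hi → AddSubgroup.torsionBy Pt n := fun τ ↦ ⟨f τ, hfn τ⟩
  have hfTcont : Continuous fT :=
    ((continuous_of_discreteTopology (f := fun q : Pt ↦ q - Q)).comp
      ((continuous_smul_localPoints W E Q).comp continuous_subtype_val)).subtype_mk _
  let fB : Hi → B := fun τ ↦ θ.symm (fT τ)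
  have hfBcont : Continuous fB := (continuous_of_discreteTopology (f := fun T ↦ θ.symm T)).comp hfTcont
  have hfBpt : ∀ τ : Hi, ι (fB τ) = f τ := fun τ ↦ by change ι (θ.symm (fT τ)) = _; rw [hιθsymm]
  -- the twisted module restricted to `Γ_E`: plain on `H`, `−g` at `g`
  let X : ContinuousRep G ℤ B := (W.twistedTorsionGaloisModule 2 κ J (-1) hu).restrictField E
  have hXapp : ∀ (σ : G) (m : B), X σ m =
      (-1 : ℤ) ^ κ.twistExponent J (resGal (K := K) E σ) • (resGal (K := K) E σ • m) := fun σ m ↦ by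
    change W.twistedTorsionGaloisModule 2 κ J (-1) hu (resGal (K := K) E σ) m = _
    rw [ZpExtension.galoisTwist_apply_apply, torsionGaloisModule_apply_apply]
  have hXHi : ∀ (σ : G), σ ∈ Hi → ∀ m : B, X σ m = resGal (K := K) E σ • m := by
    intro σ hσ m
    have hσ' : resGal (K := K) E σ ∈ κ.kerSubgroup := (mem_localSubgroup_iff _ _ σ).mp hσ
    rw [hXapp, ZpExtension.twistExponent_eq_zero_of_mem_kerSubgroup κ hσ', pow_zero, one_smul]
  have hXg : ∀ m : B, X g m = -(resGal (K := K) E g • m) := by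
    intro m
    have hκ1 : (κ (resGal (K := K) E g)).toAdd = ((1 : ℕ) : ℤ_[2]) := by
      rw [Nat.cast_one]; exact congrArg Multiplicative.toAdd hκg
    have hexp : κ.twistExponent J (resGal (K := K) E g) = 1 % 2 ^ J := by
      change (PadicInt.toZModPow J (κ (resGal (K := K) E g)).toAdd).val = 1 % 2 ^ J
      rw [hκ1, map_natCast, ZMod.val_natCast]
    rw [hXapp, hexp, ZpExtension.pow_mod_zsmul_eq (W.pow_nsmul_geomTorsion_pow 2 J) hu, pow_one, neg_one_zsmul]
  -- the cocycle `cB` on `H`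
  let cB : contOneCocycles (subgroupRep X.toTopRep Hi) :=
    ⟨⟨fB, hfBcont⟩, fun σ τ ↦ by
      change fB (σ * τ) = fB σ + X (σ : G) (fB τ)
      rw [hXHi _ σ.2]
      apply hιinj
      rw [hιadd, hιgal, hfBpt, hfBpt, hfBpt]
      exact hfmul σ τ⟩
  have hcB : ∀ τ : Hi, cB.1 τ = fB τ := fun _ ↦ rfl
  -- (3) twisted `g`-invariance of `[cB]`: `−g•f(g⁻¹τg) − f(τ) = τP′ − P′`, `P′ = g•w − (gQ + Q)`
  obtain ⟨w, hwM, hw⟩ := hanti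
  set P' : Pt := g • w - (g • Q + Q) with hP'def
  have hP'n : P' ∈ AddSubgroup.torsionBy Pt n := by
    refine (Submodule.mem_torsionBy_iff _ _).mpr ?_
    change ((2 ^ J : ℕ) : ℤ) • (g • w - (g • Q + Q)) = 0
    rw [natCast_zsmul, smul_sub, ← galois_smul_nsmul, hw, smul_add (2 ^ J), ← galois_smul_nsmul, hQ', smul_add g,
      smul_smul, mul_inv_cancel, one_smul]
    abel
  let bP : B := θ.symm ⟨P', hP'n⟩
  have hbP : ι bP = P' := hιθsymm ⟨P', hP'n⟩
  have hgc : ∀ τ : Hi, ((subgroupConj Hi g τ : Hi) : G) = g⁻¹ * τ * g := fun τ ↦ subgroupConj_apply_coe Hi g τ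
  have hinvB : conjMap X.toTopRep Hi g 1 (oneCocycleClass _ cB) = oneCocycleClass _ cB := by
    rw [conjMap_oneCocycleClass, ← sub_eq_zero, ← oneCocycleClass_sub, oneCocycleClass_eq_zero_iff]
    refine ⟨bP, fun τ ↦ ?_⟩
    rw [Submodule.coe_sub, ContinuousMap.sub_apply, conj_pullback_apply]
    change X g (cB.1 (subgroupConj Hi g τ)) - cB.1 τ = X (τ : G) bP - bP
    rw [hcB, hcB, hXg, hXHi _ τ.2]
    apply hιinj
    rw [hιsub, hιneg, hιgal, hfBpt, hfBpt, hιsub, hιgal, hbP, hfdef, hfdef, hgc]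
    have e2 : g • ((g⁻¹ * (τ : G) * g) • Q) = (τ : G) • g • Q := by
      rw [← mul_smul, ← mul_smul, ← mul_assoc, ← mul_assoc, mul_inv_cancel, one_mul]
    have hgw : (τ : G) • (g • w) = g • w := hfix (hstab g hwM) τ
    rw [smul_sub g, e2, hP'def, smul_sub (τ : G), smul_add (τ : G), hgw]
    abel
  -- (4) `res : H¹(Γ_E, E[2^J](ψ₂)) → H¹(H, ·)^{g}` is onto: a class `ξc` restricting to `[cB]`
  have hBprim : ∀ b : B, ∃ e : ℕ, 2 ^ e • b = 0 := fun b ↦ ⟨J, W.pow_nsmul_geomTorsion_pow 2 J b⟩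
  obtain ⟨ξc, hξc⟩ := exists_resSubgroup_eq_of_conjMap_eq_of_padicInt X hBprim κE Hi hL hg1 (oneCocycleClass _ cB) hinvB
  -- (5) `ξc` lies in the ♭-condition with datum `(Q + ι b, J)`
  have hmem : ξc ∈ W.twistedSharpFlatLocalKummer 2 κ J (-1) hu E M 𝒦 := by
    obtain ⟨ξ, rfl⟩ := oneCocycleClass_surjective _ ξc
    have hres := hξc
    rw [resSubgroup_oneCocycleClass, ← sub_eq_zero, ← oneCocycleClass_sub, oneCocycleClass_eq_zero_iff] at hres
    obtain ⟨b, hb⟩ := hres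
    have hb' : ∀ τ : Hi, ξ.1 (τ : G) = fB τ + (resGal (K := K) E (τ : G) • b - b) := by
      intro τ
      have h := hb τ
      rw [Submodule.coe_sub, ContinuousMap.sub_apply, resSubgroup_pullback_apply] at h
      change ξ.1 (τ : G) - fB τ = X (τ : G) b - b at h
      rw [hXHi _ τ.2] at h
      rw [← h]; abel
    have hQb : 2 ^ J • (Q + ι b) ∈ M := by
      rw [smul_add, hQ', hιn, add_zero]; exact hxM
    refine ⟨ξ, Q + ι b, J, hQb, rfl, fun z hz ↦ ?_, fun τ ↦ ?_⟩
    · have e : (⟨2 ^ J • (Q + ι b), hQb⟩ : ↥M) = ⟨x, hxM⟩ := by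
        apply Subtype.ext
        change 2 ^ J • (Q + ι b) = x
        rw [smul_add, hQ', hιn, add_zero]
      rw [e]; exact_mod_cast hdiv z hz
    · change ι (ξ.1 (τ : G)) = (τ : G) • (Q + ι b) - (Q + ι b)
      rw [hb', hιadd, hfBpt, hιsub, hιgal, hfdef, smul_add]
      abel
  -- (6) the order of `ξc`: `d • ξc = 0 ⟹ 2^J ∣ d`
  obtain ⟨z₀, hz₀⟩ := hprim
  have hN : ∀ y : ↥M, 2 • y = 0 → y = 0 := fun y hy ↦
    Subtype.ext (hnt _ y.2 (by rw [← AddSubgroupClass.coe_nsmul, hy]; rfl))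
  have horder : ∀ d : ℕ, d • ξc = 0 → 2 ^ J ∣ d := by
    intro d hd
    have hres : resSubgroup X.toTopRep Hi 1 (d • ξc) = d • oneCocycleClass _ cB := by rw [map_nsmul, hξc]
    rw [hd, map_zero, eq_comm, ← oneCocycleClassₗ_apply, ← map_nsmul, oneCocycleClassₗ_apply,
      oneCocycleClass_eq_zero_iff] at hres
    obtain ⟨m, hm⟩ := hres
    -- `d•Q − ι m` is a tower point
    have hy : d • Q - ι m ∈ M := by
      show d • Q - ι m ∈ localTowerPointsOfEmb κ (closureEmb (K := K) E) W
      rw [mem_localTowerPointsOfEmb_iff]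
      intro τ hτ
      have h := hm ⟨τ, hτ⟩
      rw [Submodule.coe_smul_of_tower, ContinuousMap.smul_apply] at h
      change d • cB.1 ⟨τ, hτ⟩ = X τ m - m at h
      rw [hcB, hXHi τ hτ] at h
      have h' := congrArg ι h
      rw [hιnsmul, hfBpt, hιsub, hιgal, hfdef] at h'
      change d • (τ • Q - Q) = τ • ι m - ι m at h'
      rw [smul_sub, ← galois_smul_nsmul] at h'
      rw [smul_sub, sub_eq_sub_iff_sub_eq_sub, h']
    -- `2^J • (d•Q − ι m) = d • x`
    have hyx : 2 ^ J • (⟨d • Q - ι m, hy⟩ : ↥M) = d • ⟨x, hxM⟩ := by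
      apply Subtype.ext
      rw [AddSubgroupClass.coe_nsmul, AddSubgroupClass.coe_nsmul]
      change 2 ^ J • (d • Q - ι m) = d • x
      rw [smul_sub, smul_comm, hQ', hιn, sub_zero]
    -- read with `z₀`: `2^J ∣ d · z₀(x)`, `z₀(x)` a unit
    have hdz : (2 : ℤ_[2]) ^ J ∣ (d : ℤ_[2]) * z₀ ⟨x, hxM⟩ := by
      refine ⟨z₀ ⟨d • Q - ι m, hy⟩, ?_⟩
      have h := congrArg z₀ hyx
      rw [map_nsmul, map_nsmul, nsmul_eq_mul, nsmul_eq_mul] at h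
      rw [← h]; push_cast; ring
    have hunit : IsUnit (z₀ ⟨x, hxM⟩) := SSFlatEC.padicInt_isUnit_iff_not_dvd.mpr hz₀
    rw [hunit.dvd_mul_right] at hdz
    have hdz' : ((2 : ℤ_[2]) ^ J : ℤ_[2]) ∣ ((d : ℤ) : ℤ_[2]) := by exact_mod_cast hdz
    have h2 := (PadicInt.pow_p_dvd_int_iff (p := 2) J (d : ℤ)).mp (by exact_mod_cast hdz')
    exact_mod_cast h2
  -- (7) the `2^J` multiples of `ξc` are distinct classes of the ♭-condition
  haveI : Finite ↥(W.twistedSharpFlatLocalKummer 2 κ J (-1) hu E M 𝒦) := inferInstance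
  let φ : Fin (2 ^ J) → ↥(W.twistedSharpFlatLocalKummer 2 κ J (-1) hu E M 𝒦) :=
    fun i ↦ ⟨(i : ℕ) • ξc, AddSubgroup.nsmul_mem _ hmem _⟩
  have hφ : Function.Injective φ := by
    intro i j hij
    have h : (i : ℕ) • ξc = (j : ℕ) • ξc := congrArg Subtype.val hij
    apply Fin.ext
    rcases le_total (i : ℕ) (j : ℕ) with hle | hle
    · have e : ((j : ℕ) - (i : ℕ)) • ξc + (i : ℕ) • ξc = (j : ℕ) • ξc := by rw [← add_nsmul, Nat.sub_add_cancel hle]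
      have h0 : ((j : ℕ) - (i : ℕ)) • ξc = 0 := by rw [eq_sub_of_add_eq e, ← h, sub_self]
      have hd := horder _ h0
      have hlt : (j : ℕ) - (i : ℕ) < 2 ^ J := lt_of_le_of_lt (Nat.sub_le _ _) j.2
      have : (j : ℕ) - (i : ℕ) = 0 := Nat.eq_zero_of_dvd_of_lt hd hlt
      omega
    · have e : ((i : ℕ) - (j : ℕ)) • ξc + (j : ℕ) • ξc = (i : ℕ) • ξc := by rw [← add_nsmul, Nat.sub_add_cancel hle]
      have h0 : ((i : ℕ) - (j : ℕ)) • ξc = 0 := by rw [eq_sub_of_add_eq e, h, sub_self]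
      have hd := horder _ h0
      have hlt : (i : ℕ) - (j : ℕ) < 2 ^ J := lt_of_le_of_lt (Nat.sub_le _ _) i.2
      have : (i : ℕ) - (j : ℕ) = 0 := Nat.eq_zero_of_dvd_of_lt hd hlt
      omega
  have hcard := Nat.card_le_card_of_injective φ hφ
  rwa [Nat.card_eq_fintype_card, Fintype.card_fin] at hcard

end Generic

end OddBlindLocal

end Summit.BirchSwinnertonDyer.BirchSwinnertonDyer.Theorems

end
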